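import Literature.AlgebraicGeometry.Motives.HodgeStructureOfCMTypeThetaHull
import Literature.AlgebraicGeometry.Pohlmann1968.SimpleCMAbelianVarietyPowersDivisorGenerated
import HarnessLib

/-!
# Θ-rigidity of the Hodge torus of a CM abelian variety with NONDEGENERATE type — in particular of every simple CM abelian variety of prime dimension, so of every simple CM THREEFOLD: every rational Lie algebra through the Hodge operator of `H¹(Z)` commuting with the CM action contains `K⁻` (Deligne 1982 I Ex. 3.7 (c); Kubota ∕ Dodson; Pohlmann 1968 ∕ Ribet: prime degree ⟹ nondegenerate)

Family `hodge`, layer `Literature/AlgebraicGeometry/HodgeTheory` (the Betti `H¹` of an actual complex abelian variety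
realising a CM type).  Cell `pub-hodgeav-hg6` (TABLE X row 22 `Y₃ × Z₃(CM)`: the FACTOR input `hLie₂` of the product
brick for the CM factor `Z₃`, at the level the row's AV reading consumes; nothing here proves HC, HC_AV or HC_CM).
UNCONDITIONAL; theorems only, no definition, no named fact, no instance, no `sorry`.  This is the TRANSPORT of the
model-level file `Motives/HodgeStructureOfCMTypeThetaHull` (`CMTorusTheta.lmul_mem_of_theta_mem`: for a
nondegenerate CM type every rational `𝔤 ⊆ End_ℚ K` commuting with `K` whose complex span contains the Hodge operator
of `V¹_{(K,Φ)}` contains `(u · –)` for every purely imaginary `u`) along the tree's rigidity isomorphism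
`V¹_{(K,Φ)} = e^* H¹(Z)` (`CMBettiModel.exists_ofCMType_eq_comapEquiv`: every `K`-equivariant `e : K ≃ H¹(Z(ℂ); ℚ)` is
an isomorphism of Hodge structures), plus the number theory already in the tree: a SIMPLE realisation has a PRIMITIVE
type (`isSimple_iff_isPrimitive`, Shimura §8.2 Prop. 26) and a primitive type of a CM field of degree `2p`, `p` prime, is
NONDEGENERATE (`Pohlmann1968.isNondegenerate_of_isPrimitive_of_prime`).

RESULTS (`h : IsCMTypeRealisation Φ Z ι θ`, `η = BettiUniverse.cmAction θ _ : K →ₐ[ℚ] End_ℚ H¹(Z(ℂ); ℚ)` the rational CM action,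
`H¹(Z) = BettiUniverse.hodge hHD (AbelianVariety.isSmoothProjective_holds) 1` — the SAME Hodge structure the TABLE X files
use; `𝔤 ⊆ End_ℚ H¹(Z(ℂ); ℚ)` ANY rational subspace commuting with `η(K)` whose complex span `spanC 𝔤` contains an operator
`Θ` acting by `2p − 1` on `H^{p,1−p}`):
* §1 `CMTorusTheta.hodge_eq_of_isCMTypeRealisation` (the dimension index of the realisation's witness is `dim Z`),
  `CMTorusTheta.isNondegenerate_of_isSimple_of_prime` (simple + prime dimension ⟹ nondegenerate type).
* §2 **`CMTorusTheta.cmAction_mem_of_theta_mem`** (`hnd : IsNondegenerate Φ`): `η u ∈ 𝔤` for every `u ∈ K` with `ū = −u`;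
  **`CMTorusTheta.cmAction_baseChange_mem_spanC_of_theta_mem`**: `(η u)_ℂ ∈ spanC 𝔤` — the lead's `hLie₂` «every
  element of `F⁻` lies in `spanC 𝔤₂` for every admissible `𝔤₂ ∋ Θ₂`» (no bracket ∕ skewness hypothesis needed).
* §3 the packaging **`CMTorusTheta.cmAction_mem_of_theta_mem_of_isSimple_of_prime`** (`Z` simple of prime dimension) and
  **`CMTorusTheta.cmAction_mem_of_theta_mem_of_isSimple_threefold`** (`dim Z = 3`: the row-22 factor `Z₃`), with their
  `spanC` forms.

## References
* [Deligne1982HodgeCycles] P. Deligne, *Hodge cycles on abelian varieties*, LNM 900 (1982), I Ex. 3.7 (b)–(c), I §3 (3.4).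
* [Dodson1987] B. Dodson, J. Algebra 111 (1987), §1.1 pp. 50–51 (rank; nondegenerate types).
* [Shimura1998] G. Shimura, *Abelian Varieties with Complex Multiplication and Modular Functions* (1998), §5.2, §8.2 Prop. 26.
* [MoonenZarhin1999LowDim] B. Moonen, Yu. Zarhin, Math. Ann. 315 (1999), §2 (2.1)–(2.3), Thm. (2.7) (prime dimension).
* [Gordon1999HodgeAVSurvey] B. B. Gordon, arXiv:alg-geom/9709030, 2.12–2.13, Thm. 6.3 Corollary and Remark (Tankeev–Ribet).
* [GreenGriffithsKerr2012] M. Green, P. Griffiths, M. Kerr, *Mumford–Tate Groups and Domains* (2012), §V.B («`V¹_{(K,Σ)} = H¹(A)`»).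
-/

noncomputable section

open scoped TensorProduct Pointwise
open Module NumberField CategoryTheory

namespace Literature.AlgebraicGeometry.HodgeTheory

open Literature.AlgebraicTopology.SingularHomology
open Literature.AlgebraicGeometry.Motives (IsSmoothProjective AbelianVariety bettiCohomology CMType HodgeTensorFacts)
open Literature.AlgebraicGeometry.Motives.HodgeStructure
open Literature.AlgebraicGeometry.ComplexMultiplication (IsCMTypeRealisation)
open Literature.NumberTheory.ComplexMultiplication
open Literature.AlgebraicGeometry.Pohlmann1968 (cmTypeRank IsNondegenerate isNondegenerate_iff
  isNondegenerate_of_isPrimitive_of_prime finrank_eq_two_mul_dim_of_isCMTypeRealisation)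
open Literature.Barriers.HodgeConjecture

variable {K : Type} [Field K] [NumberField K] {Φ : CMType K} {Z : AbelianVariety ℂ} {ι : 𝓞 K →+* End Z}
  {θ : K →+* Module.End ℂ (complexBetti Z.X 1)}

/-! ### §1 The realisation's Hodge structure is the canonical `H¹(Z)`; simple + prime dimension ⟹ nondegenerate -/

/-- The universe Hodge structure `BettiUniverse.hodge hHD hX 1` does not depend on the dimension index of the
smooth-projective witness `hX` (two witnesses for one `X` at equal indices give the same structure). [folklore] -/
private theorem hodge_congr' {X : Motives.SchemeOver ℂ} {n m : ℕ} (hHD : exists_isReal_hodgeModel)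
    (hn : IsSmoothProjective n X) (hm : IsSmoothProjective m X) (hnm : n = m) (k : ℕ) :
    BettiUniverse.hodge hHD hn k = BettiUniverse.hodge hHD hm k := by
  subst hnm
  rfl

/-- **The Hodge structure of a realisation is the canonical one of the abelian variety**: the witness
`h.1 : IsSmoothProjective ([K:ℚ]/2) Z.X` of a realisation of `(K; Φ)` and the abelian variety's own witness at `dim Z`
give the SAME `H¹(Z) = BettiUniverse.hodge … 1` (`[K:ℚ] = 2 dim Z`). [cite: Shimura1998, §5.2 («[F : ℚ] = 2n»)] -/
theorem CMTorusTheta.hodge_eq_of_isCMTypeRealisation (h : IsCMTypeRealisation Φ Z ι θ) (hHD : exists_isReal_hodgeModel) :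
    BettiUniverse.hodge hHD h.1 1 = BettiUniverse.hodge hHD (AbelianVariety.isSmoothProjective_holds (A := Z)) 1 :=
  hodge_congr' hHD h.1 _ (by rw [finrank_eq_two_mul_dim_of_isCMTypeRealisation h]; omega) 1

variable [IsCMField K]

/-- **A SIMPLE CM abelian variety of PRIME dimension has a NONDEGENERATE CM type** (the type of a simple realisation is
primitive — Shimura §8.2 Prop. 26, the tree's `isSimple_iff_isPrimitive` —, and a primitive type of a CM field of degree
`2p` is nondegenerate — the tree's `Pohlmann1968.isNondegenerate_of_isPrimitive_of_prime`, Tankeev–Ribet ∕ Moonen–Zarhin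
(2.7) in Dodson's rank language); in particular EVERY simple CM threefold. [cite: Shimura1998, §8.2 Prop. 26]
[cite: MoonenZarhin1999LowDim, Thm. (2.7)] [cite: Dodson1987, §1.1 (pp. 50–51)] -/
theorem CMTorusTheta.isNondegenerate_of_isSimple_of_prime (h : IsCMTypeRealisation Φ Z ι θ) (hZs : Z.IsSimple)
    (hp : Z.dim.Prime) : IsNondegenerate Φ := by
  have hK : Module.finrank ℚ K = 2 * Z.dim := finrank_eq_two_mul_dim_of_isCMTypeRealisation h
  have hne : Nonempty (K →+* ℂ) := by
    rw [← Fintype.card_pos_iff, Embeddings.card, hK]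
    have := hp.pos
    omega
  obtain ⟨s₀⟩ := hne
  exact isNondegenerate_of_isPrimitive_of_prime hp hK s₀
    ((Literature.AlgebraicGeometry.ComplexMultiplication.isSimple_iff_isPrimitive h s₀).1 hZs)

/-! ### §2 Transport of Θ-rigidity from `V¹_{(K,Φ)}` to `H¹(Z)` -/

/-- **Θ-RIGIDITY OF THE HODGE TORUS OF A CM ABELIAN VARIETY WITH NONDEGENERATE TYPE, rational form.**  Let `(Z, ι, θ)`
realise the NONDEGENERATE CM type `(K; Φ)`, `η = BettiUniverse.cmAction θ _` the rational CM action on `H¹(Z(ℂ); ℚ)`, and let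
`𝔤 ⊆ End_ℚ H¹(Z(ℂ); ℚ)` be ANY rational subspace commuting with `η(K)` whose complex span contains an operator `Θ`
acting by `2p − 1` on `H^{p,1−p}(Z)`.  Then `η u ∈ 𝔤` for every purely imaginary `u ∈ K` (`ū = −u`): `𝔤 ⊇ η(K⁻) =
Lie U_K`.  Proof: transport to the model along a `K`-equivariant `e : K ≃ H¹(Z;ℚ)` with `V¹_{(K,Φ)} = e^* H¹(Z)`
(`CMBettiModel.exists_ofCMType_eq_comapEquiv`): `e⁻¹ 𝔤 e ⊆ End_ℚ K` commutes with `K`, its complex span contains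
`e_ℂ⁻¹ Θ e_ℂ`, the Hodge operator of `V¹_{(K,Φ)}` (`comapEquiv_piece`), so it contains `(u · –)`
(`CMTorusTheta.lmul_mem_of_theta_mem`), and `e (u · –) e⁻¹ = η u`.
[cite: Deligne1982HodgeCycles, I Ex. 3.7 (c)] [cite: GreenGriffithsKerr2012, §V.B] [cite: MoonenZarhin1999LowDim, §2 (2.1)–(2.3)] -/
theorem CMTorusTheta.cmAction_mem_of_theta_mem [HodgeTensorFacts.{0, 0}] (h : IsCMTypeRealisation Φ Z ι θ)
    (hnd : IsNondegenerate Φ) (hHD : exists_isReal_hodgeModel) (hI : hodgePQ_independent_of_hodgeModel)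
    (𝔤 : Submodule ℚ (Module.End ℚ (bettiCohomology Z.X 1)))
    (hcomm : ∀ X ∈ 𝔤, ∀ k : K,
      X * BettiUniverse.cmAction θ h.isInducedOnIntegers k = BettiUniverse.cmAction θ h.isInducedOnIntegers k * X)
    {Θ : Module.End ℂ (ℂ ⊗[ℚ] bettiCohomology Z.X 1)}
    (hΘ : ∀ p : ℤ, ∀ x ∈ (BettiUniverse.hodge hHD (AbelianVariety.isSmoothProjective_holds (A := Z)) 1).piece p (1 - p),
      Θ x = ((2 * p - 1 : ℤ) : ℂ) • x)
    (hΘ𝔤 : Θ ∈ spanC 𝔤) {u : K} (hu : IsCMField.complexConj K u = -u) :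
    BettiUniverse.cmAction θ h.isInducedOnIntegers u ∈ 𝔤 := by
  classical
  obtain ⟨e, he, hH⟩ := CMBettiModel.exists_ofCMType_eq_comapEquiv h hHD hI
  rw [CMTorusTheta.hodge_eq_of_isCMTypeRealisation h hHD] at hH
  set H := BettiUniverse.hodge hHD (AbelianVariety.isSmoothProjective_holds (A := Z)) 1 with hHdef
  set η := BettiUniverse.cmAction θ h.isInducedOnIntegers with hηdef
  -- `e⁻¹ (η k) = (k · –) e⁻¹`
  have he' : ∀ (k : K) (w : bettiCohomology Z.X 1), e.symm (η k w) = k * e.symm w := by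
    intro k w
    apply e.injective
    rw [e.apply_symm_apply, he, e.apply_symm_apply]
  -- the pulled-back subspace `𝔤₀ = e⁻¹ 𝔤 e ⊆ End_ℚ K`
  set 𝔤₀ : Submodule ℚ (Module.End ℚ K) := 𝔤.map (e.symm.conj : Module.End ℚ (bettiCohomology Z.X 1) ≃ₗ[ℚ]
    Module.End ℚ K).toLinearMap with h𝔤₀
  have hmem₀ : ∀ X₀ ∈ 𝔤₀, ∃ X ∈ 𝔤, X₀ = e.symm.conj X := by
    intro X₀ hX₀
    obtain ⟨X, hX, rfl⟩ := Submodule.mem_map.1 hX₀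
    exact ⟨X, hX, rfl⟩
  have hconj : ∀ (X : Module.End ℚ (bettiCohomology Z.X 1)) (v : K), e.symm.conj X v = e.symm (X (e v)) := by
    intro X v
    rw [LinearEquiv.conj_apply_apply, LinearEquiv.symm_symm]
  -- `𝔤₀` commutes with `K`
  have hcomm₀ : ∀ X₀ ∈ 𝔤₀, ∀ k : K,
      X₀ * (Algebra.lmul ℚ K k : Module.End ℚ K) = (Algebra.lmul ℚ K k : Module.End ℚ K) * X₀ := by
    intro X₀ hX₀ k
    obtain ⟨X, hX, rfl⟩ := hmem₀ X₀ hX₀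
    refine LinearMap.ext fun v => ?_
    change e.symm.conj X (k * v) = k * e.symm.conj X v
    rw [hconj, hconj, he, ← Module.End.mul_apply, hcomm X hX k, Module.End.mul_apply, he']
  -- the complexified conjugations
  set E := e.toLinearMap.baseChange ℂ with hE
  set E' := e.symm.toLinearMap.baseChange ℂ with hE'
  have hE'E : ∀ x, E' (E x) = x := symm_baseChange_apply_baseChange e
  have hEE' : ∀ y, E (E' y) = y := baseChange_apply_symm_baseChange e
  -- the pulled-back Hodge operator `Θ₀ = e_ℂ⁻¹ Θ e_ℂ` of `V¹_{(K,Φ)}`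
  set Θ₀ : Module.End ℂ (ℂ ⊗[ℚ] K) := E' ∘ₗ Θ ∘ₗ E with hΘ₀
  have hΘ₀ : ∀ p : ℤ, ∀ x ∈ (ofCMType Φ).piece p (1 - p), Θ₀ x = ((2 * p - 1 : ℤ) : ℂ) • x := by
    intro p x hx
    rw [hH, comapEquiv_piece, Submodule.mem_comap] at hx
    change E' (Θ (E x)) = _
    rw [hΘ p _ hx, map_smul, hE'E]
  -- `Θ₀ ∈ spanC 𝔤₀`: conjugation carries `spanC 𝔤` into `spanC 𝔤₀`
  set C : Module.End ℂ (ℂ ⊗[ℚ] bettiCohomology Z.X 1) →ₗ[ℂ] Module.End ℂ (ℂ ⊗[ℚ] K) :=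
    (LinearMap.llcomp ℂ (ℂ ⊗[ℚ] K) (ℂ ⊗[ℚ] bettiCohomology Z.X 1) (ℂ ⊗[ℚ] K) E').comp (LinearMap.lcomp ℂ _ E) with hC
  have hC_apply : ∀ Y, C Y = E' ∘ₗ Y ∘ₗ E := fun Y => rfl
  have hCbase : ∀ X : Module.End ℚ (bettiCohomology Z.X 1), C (X.baseChange ℂ) = (e.symm.conj X).baseChange ℂ := by
    intro X
    rw [hC_apply, LinearEquiv.conj_apply, LinearEquiv.symm_symm, LinearMap.baseChange_comp, LinearMap.baseChange_comp]
    rfl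
  have hCspan : (spanC 𝔤).map C ≤ spanC 𝔤₀ := by
    unfold spanC
    rw [Submodule.map_span, Submodule.span_le]
    rintro _ ⟨_, ⟨X, hX, rfl⟩, rfl⟩
    refine Submodule.subset_span ⟨e.symm.conj X, ?_, (hCbase X).symm⟩
    exact Submodule.mem_map_of_mem (f := (e.symm.conj : Module.End ℚ (bettiCohomology Z.X 1) ≃ₗ[ℚ]
      Module.End ℚ K).toLinearMap) hX
  have hΘ₀𝔤 : Θ₀ ∈ spanC 𝔤₀ := hCspan (Submodule.mem_map_of_mem (f := C) hΘ𝔤)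
  -- the model theorem: `(u · –) ∈ 𝔤₀`
  have hlmul := CMTorusTheta.lmul_mem_of_theta_mem Φ hnd 𝔤₀ hcomm₀ hΘ₀ hΘ₀𝔤 hu
  obtain ⟨X, hX, hXu⟩ := hmem₀ _ hlmul
  -- `X = e (u · –) e⁻¹ = η u`
  have hXη : X = η u := by
    refine LinearMap.ext fun w => ?_
    have hw := LinearMap.congr_fun hXu (e.symm w)
    rw [hconj, e.apply_symm_apply] at hw
    change u * e.symm w = e.symm (X w) at hw
    apply e.symm.injective
    rw [he', hw]
  rw [← hXη]
  exact hX

/-- **Complex form — the `hLie₂` of the TABLE X product brick for a CM factor**: `(η u)_ℂ ∈ spanC 𝔤` for every purely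
imaginary `u ∈ K`, for every rational `𝔤 ⊆ End_ℚ H¹(Z;ℚ)` commuting with the CM action whose complex span contains the
Hodge operator — «`spanC 𝔤 ⊇ η(K⁻)_ℂ = 𝔲_K ⊗ ℂ`», nondegenerate type.
[cite: Deligne1982HodgeCycles, I Ex. 3.7 (c)] [cite: MoonenZarhin1999LowDim, §2 (2.1)–(2.3)] -/
theorem CMTorusTheta.cmAction_baseChange_mem_spanC_of_theta_mem [HodgeTensorFacts.{0, 0}]
    (h : IsCMTypeRealisation Φ Z ι θ) (hnd : IsNondegenerate Φ) (hHD : exists_isReal_hodgeModel)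
    (hI : hodgePQ_independent_of_hodgeModel) (𝔤 : Submodule ℚ (Module.End ℚ (bettiCohomology Z.X 1)))
    (hcomm : ∀ X ∈ 𝔤, ∀ k : K,
      X * BettiUniverse.cmAction θ h.isInducedOnIntegers k = BettiUniverse.cmAction θ h.isInducedOnIntegers k * X)
    {Θ : Module.End ℂ (ℂ ⊗[ℚ] bettiCohomology Z.X 1)}
    (hΘ : ∀ p : ℤ, ∀ x ∈ (BettiUniverse.hodge hHD (AbelianVariety.isSmoothProjective_holds (A := Z)) 1).piece p (1 - p),
      Θ x = ((2 * p - 1 : ℤ) : ℂ) • x)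
    (hΘ𝔤 : Θ ∈ spanC 𝔤) {u : K} (hu : IsCMField.complexConj K u = -u) :
    (BettiUniverse.cmAction θ h.isInducedOnIntegers u).baseChange ℂ ∈ spanC 𝔤 :=
  baseChange_mem_spanC (CMTorusTheta.cmAction_mem_of_theta_mem h hnd hHD hI 𝔤 hcomm hΘ hΘ𝔤 hu)

/-! ### §3 Simple CM abelian varieties of prime dimension; simple CM threefolds (TABLE X row 22's `Z₃`) -/

/-- **Θ-rigidity of the Hodge torus of a SIMPLE CM abelian variety of PRIME dimension** (its type is nondegenerate, §1):
every rational `𝔤 ⊆ End_ℚ H¹(Z;ℚ)` commuting with the CM action whose complex span contains the Hodge operator contains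
`η u` for every purely imaginary `u ∈ K` — «`Hg(Z) = U_K`» (Tankeev–Ribet, Moonen–Zarhin (2.7), CM case) in HULL form.
[cite: MoonenZarhin1999LowDim, Thm. (2.7)] [cite: Gordon1999HodgeAVSurvey, Thm. 6.3 Corollary and Remark] [cite: Deligne1982HodgeCycles, I Ex. 3.7 (c)] -/
theorem CMTorusTheta.cmAction_mem_of_theta_mem_of_isSimple_of_prime [HodgeTensorFacts.{0, 0}]
    (h : IsCMTypeRealisation Φ Z ι θ) (hZs : Z.IsSimple) (hp : Z.dim.Prime) (hHD : exists_isReal_hodgeModel)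
    (hI : hodgePQ_independent_of_hodgeModel) (𝔤 : Submodule ℚ (Module.End ℚ (bettiCohomology Z.X 1)))
    (hcomm : ∀ X ∈ 𝔤, ∀ k : K,
      X * BettiUniverse.cmAction θ h.isInducedOnIntegers k = BettiUniverse.cmAction θ h.isInducedOnIntegers k * X)
    {Θ : Module.End ℂ (ℂ ⊗[ℚ] bettiCohomology Z.X 1)}
    (hΘ : ∀ p : ℤ, ∀ x ∈ (BettiUniverse.hodge hHD (AbelianVariety.isSmoothProjective_holds (A := Z)) 1).piece p (1 - p),
      Θ x = ((2 * p - 1 : ℤ) : ℂ) • x)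
    (hΘ𝔤 : Θ ∈ spanC 𝔤) {u : K} (hu : IsCMField.complexConj K u = -u) :
    BettiUniverse.cmAction θ h.isInducedOnIntegers u ∈ 𝔤 :=
  CMTorusTheta.cmAction_mem_of_theta_mem h (CMTorusTheta.isNondegenerate_of_isSimple_of_prime h hZs hp) hHD hI 𝔤 hcomm
    hΘ hΘ𝔤 hu

/-- **The same in complex form**: `(η u)_ℂ ∈ spanC 𝔤` for `Z` simple CM of prime dimension.
[cite: MoonenZarhin1999LowDim, Thm. (2.7)] [cite: Deligne1982HodgeCycles, I Ex. 3.7 (c)] -/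
theorem CMTorusTheta.cmAction_baseChange_mem_spanC_of_theta_mem_of_isSimple_of_prime [HodgeTensorFacts.{0, 0}]
    (h : IsCMTypeRealisation Φ Z ι θ) (hZs : Z.IsSimple) (hp : Z.dim.Prime) (hHD : exists_isReal_hodgeModel)
    (hI : hodgePQ_independent_of_hodgeModel) (𝔤 : Submodule ℚ (Module.End ℚ (bettiCohomology Z.X 1)))
    (hcomm : ∀ X ∈ 𝔤, ∀ k : K,
      X * BettiUniverse.cmAction θ h.isInducedOnIntegers k = BettiUniverse.cmAction θ h.isInducedOnIntegers k * X)
    {Θ : Module.End ℂ (ℂ ⊗[ℚ] bettiCohomology Z.X 1)}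
    (hΘ : ∀ p : ℤ, ∀ x ∈ (BettiUniverse.hodge hHD (AbelianVariety.isSmoothProjective_holds (A := Z)) 1).piece p (1 - p),
      Θ x = ((2 * p - 1 : ℤ) : ℂ) • x)
    (hΘ𝔤 : Θ ∈ spanC 𝔤) {u : K} (hu : IsCMField.complexConj K u = -u) :
    (BettiUniverse.cmAction θ h.isInducedOnIntegers u).baseChange ℂ ∈ spanC 𝔤 :=
  baseChange_mem_spanC
    (CMTorusTheta.cmAction_mem_of_theta_mem_of_isSimple_of_prime h hZs hp hHD hI 𝔤 hcomm hΘ hΘ𝔤 hu)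

/-- **TABLE X row 22's CM factor `Z₃`: for a SIMPLE CM THREEFOLD every admissible rational `𝔤` through the Hodge operator
of `H¹(Z₃)` contains the whole compact torus Lie algebra `η(K⁻) = 𝔲_K` (`K = End⁰(Z₃)` sextic CM)** — the factor
statement «`Hg(Z₃) = U_F`, rank `3`» of the row-22 product brick, in the hull form its `hLie₂` consumes (`3` is prime).
[cite: MoonenZarhin1999LowDim, Thm. (2.7) and §2 (2.1)–(2.3)] [cite: Deligne1982HodgeCycles, I Ex. 3.7 (c)] -/
theorem CMTorusTheta.cmAction_mem_of_theta_mem_of_isSimple_threefold [HodgeTensorFacts.{0, 0}]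
    (h : IsCMTypeRealisation Φ Z ι θ) (hZs : Z.IsSimple) (hZ3 : Z.dim = 3) (hHD : exists_isReal_hodgeModel)
    (hI : hodgePQ_independent_of_hodgeModel) (𝔤 : Submodule ℚ (Module.End ℚ (bettiCohomology Z.X 1)))
    (hcomm : ∀ X ∈ 𝔤, ∀ k : K,
      X * BettiUniverse.cmAction θ h.isInducedOnIntegers k = BettiUniverse.cmAction θ h.isInducedOnIntegers k * X)
    {Θ : Module.End ℂ (ℂ ⊗[ℚ] bettiCohomology Z.X 1)}
    (hΘ : ∀ p : ℤ, ∀ x ∈ (BettiUniverse.hodge hHD (AbelianVariety.isSmoothProjective_holds (A := Z)) 1).piece p (1 - p),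
      Θ x = ((2 * p - 1 : ℤ) : ℂ) • x)
    (hΘ𝔤 : Θ ∈ spanC 𝔤) {u : K} (hu : IsCMField.complexConj K u = -u) :
    BettiUniverse.cmAction θ h.isInducedOnIntegers u ∈ 𝔤 :=
  CMTorusTheta.cmAction_mem_of_theta_mem_of_isSimple_of_prime h hZs (hZ3 ▸ Nat.prime_three) hHD hI 𝔤 hcomm hΘ hΘ𝔤 hu

/-- **Row 22's CM factor, complex form**: `(η u)_ℂ ∈ spanC 𝔤` for a simple CM threefold.
[cite: MoonenZarhin1999LowDim, Thm. (2.7)] [cite: Deligne1982HodgeCycles, I Ex. 3.7 (c)] -/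
theorem CMTorusTheta.cmAction_baseChange_mem_spanC_of_theta_mem_of_isSimple_threefold [HodgeTensorFacts.{0, 0}]
    (h : IsCMTypeRealisation Φ Z ι θ) (hZs : Z.IsSimple) (hZ3 : Z.dim = 3) (hHD : exists_isReal_hodgeModel)
    (hI : hodgePQ_independent_of_hodgeModel) (𝔤 : Submodule ℚ (Module.End ℚ (bettiCohomology Z.X 1)))
    (hcomm : ∀ X ∈ 𝔤, ∀ k : K,
      X * BettiUniverse.cmAction θ h.isInducedOnIntegers k = BettiUniverse.cmAction θ h.isInducedOnIntegers k * X)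
    {Θ : Module.End ℂ (ℂ ⊗[ℚ] bettiCohomology Z.X 1)}
    (hΘ : ∀ p : ℤ, ∀ x ∈ (BettiUniverse.hodge hHD (AbelianVariety.isSmoothProjective_holds (A := Z)) 1).piece p (1 - p),
      Θ x = ((2 * p - 1 : ℤ) : ℂ) • x)
    (hΘ𝔤 : Θ ∈ spanC 𝔤) {u : K} (hu : IsCMField.complexConj K u = -u) :
    (BettiUniverse.cmAction θ h.isInducedOnIntegers u).baseChange ℂ ∈ spanC 𝔤 :=
  baseChange_mem_spanC
    (CMTorusTheta.cmAction_mem_of_theta_mem_of_isSimple_threefold h hZs hZ3 hHD hI 𝔤 hcomm hΘ hΘ𝔤 hu)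

end Literature.AlgebraicGeometry.HodgeTheory

end
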